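import Summits.QuantumFields.YangMills.Theorems.UV3StartClosedOfTopHaarPushforward
import Summits.QuantumFields.YangMills.Theorems.AlphaInputsT3ACv3
import Summits.QuantumFields.YangMills.Theorems.AlphaInputsT3ACv3Step
import HarnessLib

/-!
# UV3 ∕ R3 crux `HistoryTailL` (stmt-QuantumFields-19936), line `pinned_stability` — THE v3 N08 JUNCTION: the displayed residual row hJ(v3)
# («top-level a.e. envelope of the K-fold transported PINNED masses of `blockAvg ℰp`») AT ITS EXACT DISPLAY LETTER from the N08 letters at `avT3`

Helper seat `ym-ust-19936-w6` (gen 7), ★★OWNER WORD 72 (the v3 N08 junction; NOT an `(a)′∀` twin).  The R-19936-S∕U organs over the GUARDED v3 socket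
are in the tree modulo ONE displayed row hJ(v3) (✓`AlphaInputsT3AC.OfV3At.hSii_of_massEnvelope`, ✓`AlphaInputsT3AC.OfV3At.hlf_ae_of_massEnvelope`):
`∃ A₁, ∀ K r, Admissible → r ≠ triv → ∀ᵐ W ∂dU_K, PinnedStep.massP 𝔠.lane (h.pkgAtV3 hc γ hγ hγ1 K).X K r W ≤ e^{A₁}`.  The N08 seat's
✓`BalabanUVNodesN08KFoldTransportEnvelopeT3` supplies, at the family's pinned averaging `avT3 F K` (`= blockAvg ℰp` in the standing range), the v1 junction
`hJ_of_weakClosed_avT3` (hJ(v1) ⟸ the WEAK-CLOSURE letter `hN08`) and the v3 corollary `massRecP_avT3_le_exp_ae_of_startClosed` (`massRecP … (avT3 F K) K r ≤ e^{A₁}`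
a.e. ⟸ a PER-START closed family with the K-uniform top cap).  THIS FILE closes the v3 side BY NAME — after the v4 flip the row `stub_hJ` is ONE `fun` away
from the N08 seat's letter in BOTH currencies, from THE SAME letter:
* §1 `startClosed_of_weakClosed_avT3` — the weak-closure letter (excess `ν_k ≤ (e^{A₁} − 1)·dU_k`, `(dU_k + ν_k)∘Ū_k⁻¹ ≤ dU_{k+1} + ν_{k+1}`) YIELDS a per-start
  closed family with top cap `e^{A₁}·dU_K`: `μ j k := dU_k + ν_k` (monotonicity of the push-forward; `1 + (e^{A₁} − 1) = e^{A₁}`).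
* §2 `massP_le_exp_ae_of_startClosed` ∕ `…_of_weakClosed` — for EVERY v3 package `p : PkgAtV3` and every history: `PinnedStep.massP 𝔠.lane p.X` IS
  `MassesPAC.massRecP` at the lane's carrier parameters along `p.X.av = avT3 F K` (`XT3_av`, definitional), so the N08 corollary applies verbatim.
* §4 ★★★ `AlphaInputsT3AC.OfV3At.hJ_of_topHaarPushforward` ∕ `…_of_topBlockAvgPushforward` — hJ(v3) ⟸ hTop (★★OWNER WORD 68's v5-candidate letter: ONE measure
  inequality per segment ending at the unit torus) FLAT, by name over ✓`UV3StartClosedOfTopHaarPushforward.startClosed_avT3_of_topHaarPushforward` (px8) ∘ §3.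
* §3 ★★★ `AlphaInputsT3AC.OfV3At.hJ_of_startClosed_avT3`, ★★★ `AlphaInputsT3AC.OfV3At.hJ_of_weakClosed_avT3` — hJ(v3) AT ITS EXACT DISPLAY LETTER (the `hJ`
  binder of ✓`OfV3At.hSii_of_massEnvelope` ∕ ✓`OfV3At.hlf_ae_of_massEnvelope`, VERBATIM) from either letter; the admissibility ∕ non-triviality guards are unused.

HONEST: bookkeeping only; the N08 letters (weak or per-start closure) and hTop are DISPLAYED hypotheses — the Jacobian ∕ Haar-compatibility content of the K-fold
block averaging `blockAvg ℰp` — NOT proved here; E6′ not decided; nothing of 19936 is proved by this file; rung R3 = SU(2) YM₃ on T³ — not d = 4, not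
infinite volume, not a mass gap.
-/

set_option autoImplicit false

noncomputable section

namespace Summit.QuantumFields.YangMills.Theorems.UV3PinnedMassEnvelopeV3OfN08

open MeasureTheory
open scoped ENNReal
open Literature.MathematicalPhysics.QuantumFieldTheory.Balaban1983to89
open Literature.MathematicalPhysics.QuantumFieldTheory.Balaban1983to89.T3ContinuumYM3Torus
open Literature.MathematicalPhysics.QuantumFieldTheory.Balaban1985CMP102
open Literature.MathematicalPhysics.QuantumFieldTheory.Balaban1985CMP102.Setting
open Summit.QuantumFields.Balaban3D.Carriers
open Summit.QuantumFields.Balaban3D.Proofs.Primitives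
open Summit.QuantumFields.Balaban3D.Proofs.GroupModelLieC
open Summit.QuantumFields.Balaban3D.Proofs.StandardAC
open Summit.QuantumFields.Balaban3D.Proofs.InputsAC
open Summit.QuantumFields.Balaban3D.Proofs.MassesPAC
open Summit.QuantumFields.YangMills.Theorems.BalabanUVNodesN08KFoldTransportEnvelopeT3 (massRecP_avT3_le_exp_ae_of_startClosed)
open Summit.QuantumFields.YangMills.Theorems.UV3StartClosedOfTopHaarPushforward (startClosed_avT3_of_topHaarPushforward)
open Literature.MathematicalPhysics.QuantumFieldTheory.Balaban1983to89.T4AvgSensitivity (iterFrom)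
open Literature.MathematicalPhysics.QuantumFieldTheory.Balaban1983to89.T3UnitLawDensityEML (ℰp)
open Summit.QuantumFields.YangMills.Theorems.UV3PinnedStepOrganOfTopPartialIterates (iterFrom_avT3_eq_iterFrom_blockAvg)

variable (F : T3Family)

/-! ## §1 The weak-closure letter yields a per-start closed family with the top cap -/

/-- ★ **WEAK CLOSURE ⇒ PER-START CLOSURE (same constant)**: from an excess family `ν` with `(dU_k + ν_k)∘Ū_k⁻¹ ≤ dU_{k+1} + ν_{k+1}` (`k < K`) and
`ν_k ≤ (e^{A₁} − 1)·dU_k` (`k ≤ K`), the start-independent family `μ j k := dU_k + ν_k` is closed from every start (`dU_j∘Ū_j⁻¹ ≤ (dU_j + ν_j)∘Ū_j⁻¹` by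
monotonicity of the push-forward along the measurable `avT3`) and capped at the top by `(1 + (e^{A₁} − 1))·dU_K = e^{A₁}·dU_K`.
[cite: Balaban1985UV3, (41) p.266 + (5) p.256 (the masses; bookkeeping)] -/
theorem startClosed_of_weakClosed_avT3 {A₁ : ℝ} (hA₁ : 0 ≤ A₁)
    (hN08 : ∀ K : ℕ, ∃ ν : ∀ k, Measure (GaugeField (F.P K) k (Matrix.specialUnitaryGroup (Fin 2) ℂ)),
      (∀ k, k < K → (fieldMeasure (F.P K) k _ + ν k).map (avT3 F K k).avg ≤ fieldMeasure (F.P K) (k + 1) _ + ν (k + 1)) ∧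
      (∀ k, k ≤ K → ν k ≤ ENNReal.ofReal (Real.exp A₁ - 1) • fieldMeasure (F.P K) k _)) :
    ∀ K : ℕ, ∃ μ : ℕ → ∀ k, Measure (GaugeField (F.P K) k (Matrix.specialUnitaryGroup (Fin 2) ℂ)),
      (∀ j, j < K → (fieldMeasure (F.P K) j _).map (avT3 F K j).avg ≤ μ j (j + 1)) ∧
      (∀ j k, j < k → k < K → (μ j k).map (avT3 F K k).avg ≤ μ j (k + 1)) ∧
      (∀ j, j < K → μ j K ≤ ENNReal.ofReal (Real.exp A₁) • fieldMeasure (F.P K) K _) := by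
  intro K
  obtain ⟨ν, hstep, hcap⟩ := hN08 K
  refine ⟨fun _ k => fieldMeasure (F.P K) k _ + ν k, fun j hj => ?_, fun j k _ hk => hstep k hk, fun j _ => ?_⟩
  · exact (Measure.map_mono_of_aemeasurable (Measure.le_add_right le_rfl) (avgAC_avT3 F K j).measurable.aemeasurable).trans (hstep j hj)
  · have h1 : ENNReal.ofReal (Real.exp A₁) = 1 + ENNReal.ofReal (Real.exp A₁ - 1) := by
      rw [← ENNReal.ofReal_one, ← ENNReal.ofReal_add zero_le_one (sub_nonneg.2 (Real.one_le_exp hA₁)), add_sub_cancel]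
    calc fieldMeasure (F.P K) K _ + ν K
        ≤ fieldMeasure (F.P K) K _ + ENNReal.ofReal (Real.exp A₁ - 1) • fieldMeasure (F.P K) K _ := add_le_add le_rfl (hcap K le_rfl)
      _ = ENNReal.ofReal (Real.exp A₁) • fieldMeasure (F.P K) K _ := by rw [h1, add_smul, one_smul]

/-! ## §2 Every v3 package: the pinned masses `massP` ARE `massRecP` along `avT3 F K` -/

variable (𝔠 : AlphaConsts F.L (suGroupModel 2).N) (γ : ℝ) (hγ : 0 < γ) (hγ1 : γ ≤ (min 𝔠.gamma0 1) ^ 2)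

/-- ★★ **THE v3 PACKAGE'S PINNED MASSES UNDER THE PER-START CLOSED FAMILY**: for every v3 package `p` at `(γ, K)` and EVERY history `r`,
`PinnedStep.massP 𝔠.lane p.X K r ≤ e^{A₁}` `dU_K`-a.e. — `massP` IS `MassesPAC.massRecP` at the lane's carrier parameters along `p.X.av = avT3 F K` (`XT3_av`,
definitional), so the N08 corollary `massRecP_avT3_le_exp_ae_of_startClosed` applies verbatim. [cite: Balaban1985UV3, (41) p.266 (the masses; bookkeeping)] -/
theorem massP_le_exp_ae_of_startClosed {A₁ : ℝ} (hA₁ : 0 ≤ A₁)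
    (hN08 : ∀ K : ℕ, ∃ μ : ℕ → ∀ k, Measure (GaugeField (F.P K) k (Matrix.specialUnitaryGroup (Fin 2) ℂ)),
      (∀ j, j < K → (fieldMeasure (F.P K) j _).map (avT3 F K j).avg ≤ μ j (j + 1)) ∧
      (∀ j k, j < k → k < K → (μ j k).map (avT3 F K k).avg ≤ μ j (k + 1)) ∧
      (∀ j, j < K → μ j K ≤ ENNReal.ofReal (Real.exp A₁) • fieldMeasure (F.P K) K _))
    (K : ℕ) (p : AlphaInputsT3AC.PkgAtV3 F 𝔠 γ hγ hγ1 K) (r : Hist (F.P K) K) :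
    ∀ᵐ W ∂(fieldMeasure (F.P K) K (Matrix.specialUnitaryGroup (Fin 2) ℂ)), PinnedStep.massP 𝔠.lane p.X K r W ≤ Real.exp A₁ :=
  massRecP_avT3_le_exp_ae_of_startClosed F hA₁ hN08 K _ _ _ _ r

/-- ★★ **… AND UNDER THE WEAK-CLOSURE LETTER** (the v1 letter `hN08` of ✓`hJ_of_weakClosed_avT3`, the SAME letter in both currencies), via §1.
[cite: Balaban1985UV3, (41) p.266 + (5) p.256 (the masses; bookkeeping)] -/
theorem massP_le_exp_ae_of_weakClosed {A₁ : ℝ} (hA₁ : 0 ≤ A₁)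
    (hN08 : ∀ K : ℕ, ∃ ν : ∀ k, Measure (GaugeField (F.P K) k (Matrix.specialUnitaryGroup (Fin 2) ℂ)),
      (∀ k, k < K → (fieldMeasure (F.P K) k _ + ν k).map (avT3 F K k).avg ≤ fieldMeasure (F.P K) (k + 1) _ + ν (k + 1)) ∧
      (∀ k, k ≤ K → ν k ≤ ENNReal.ofReal (Real.exp A₁ - 1) • fieldMeasure (F.P K) k _))
    (K : ℕ) (p : AlphaInputsT3AC.PkgAtV3 F 𝔠 γ hγ hγ1 K) (r : Hist (F.P K) K) :
    ∀ᵐ W ∂(fieldMeasure (F.P K) K (Matrix.specialUnitaryGroup (Fin 2) ℂ)), PinnedStep.massP 𝔠.lane p.X K r W ≤ Real.exp A₁ :=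
  massP_le_exp_ae_of_startClosed F 𝔠 γ hγ hγ1 hA₁ (startClosed_of_weakClosed_avT3 F hA₁ hN08) K p r

/-! ## §3 hJ(v3) at its exact display letter -/

/-- ★★★ **hJ(v3) AT ITS EXACT DISPLAY LETTER** (the `hJ` binder of ✓`AlphaInputsT3AC.OfV3At.hSii_of_massEnvelope` and ✓`AlphaInputsT3AC.OfV3At.hlf_ae_of_massEnvelope`,
VERBATIM) **FROM THE N08 PER-START CLOSED FAMILY AT `blockAvg ℰp`** (✓`massRecP_avT3_le_exp_ae_of_startClosed`'s letter): the admissibility ∕ non-triviality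
guards of the display letter are not used — the bound holds for every history of the chosen package `h.pkgAtV3 hc γ hγ hγ1 K`.
[cite: Balaban1985UV3, (41) p.266 (the masses; bookkeeping)] -/
theorem _root_.Summit.QuantumFields.YangMills.Theorems.AlphaInputsT3AC.OfV3At.hJ_of_startClosed_avT3 {a₀ a₁ : ℝ}
    (h : AlphaInputsT3AC.OfV3At F 𝔠 a₀ a₁) (hc : 0 < a₀ ∧ 0 < a₁ ∧ 𝔠.B₃ * a₁ ≤ a₀) {A₁ : ℝ} (hA₁ : 0 ≤ A₁)
    (hN08 : ∀ K : ℕ, ∃ μ : ℕ → ∀ k, Measure (GaugeField (F.P K) k (Matrix.specialUnitaryGroup (Fin 2) ℂ)),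
      (∀ j, j < K → (fieldMeasure (F.P K) j _).map (avT3 F K j).avg ≤ μ j (j + 1)) ∧
      (∀ j k, j < k → k < K → (μ j k).map (avT3 F K k).avg ≤ μ j (k + 1)) ∧
      (∀ j, j < K → μ j K ≤ ENNReal.ofReal (Real.exp A₁) • fieldMeasure (F.P K) K _)) :
    ∃ A₁ : ℝ, ∀ (K : ℕ) (r : Hist (F.P K) K),
      Hist.Admissible 𝔠.lane.carrier.M₁ (rcolOf (T3Scales F γ hγ (hγ1.trans (sq_min_one_le _ 𝔠.gamma0_pos)) K) 𝔠.lane.carrier) K r →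
      r ≠ Hist.triv (F.P K) K →
      ∀ᵐ W ∂(fieldMeasure (F.P K) K (Matrix.specialUnitaryGroup (Fin 2) ℂ)),
        PinnedStep.massP 𝔠.lane (h.pkgAtV3 hc γ hγ hγ1 K).X K r W ≤ Real.exp A₁ :=
  ⟨A₁, fun K r _ _ => massP_le_exp_ae_of_startClosed F 𝔠 γ hγ hγ1 hA₁ hN08 K (h.pkgAtV3 hc γ hγ hγ1 K) r⟩

/-- ★★★ **hJ(v3) AT ITS EXACT DISPLAY LETTER FROM THE N08 WEAK-CLOSURE LETTER `hN08`** — the SAME 287-character letter that yields hJ(v1) and hTriv(v1)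
(✓`hJ_of_weakClosed_avT3`, ✓`hTriv_of_weakClosed_avT3`): after the v4 flip the registered row `stub_hJ` is one `fun` away from the N08 seat's letter in BOTH
currencies. [cite: Balaban1985UV3, (41) p.266 + (5) p.256 (the masses; bookkeeping)] -/
theorem _root_.Summit.QuantumFields.YangMills.Theorems.AlphaInputsT3AC.OfV3At.hJ_of_weakClosed_avT3 {a₀ a₁ : ℝ}
    (h : AlphaInputsT3AC.OfV3At F 𝔠 a₀ a₁) (hc : 0 < a₀ ∧ 0 < a₁ ∧ 𝔠.B₃ * a₁ ≤ a₀) {A₁ : ℝ} (hA₁ : 0 ≤ A₁)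
    (hN08 : ∀ K : ℕ, ∃ ν : ∀ k, Measure (GaugeField (F.P K) k (Matrix.specialUnitaryGroup (Fin 2) ℂ)),
      (∀ k, k < K → (fieldMeasure (F.P K) k _ + ν k).map (avT3 F K k).avg ≤ fieldMeasure (F.P K) (k + 1) _ + ν (k + 1)) ∧
      (∀ k, k ≤ K → ν k ≤ ENNReal.ofReal (Real.exp A₁ - 1) • fieldMeasure (F.P K) k _)) :
    ∃ A₁ : ℝ, ∀ (K : ℕ) (r : Hist (F.P K) K),
      Hist.Admissible 𝔠.lane.carrier.M₁ (rcolOf (T3Scales F γ hγ (hγ1.trans (sq_min_one_le _ 𝔠.gamma0_pos)) K) 𝔠.lane.carrier) K r →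
      r ≠ Hist.triv (F.P K) K →
      ∀ᵐ W ∂(fieldMeasure (F.P K) K (Matrix.specialUnitaryGroup (Fin 2) ℂ)),
        PinnedStep.massP 𝔠.lane (h.pkgAtV3 hc γ hγ hγ1 K).X K r W ≤ Real.exp A₁ :=
  h.hJ_of_startClosed_avT3 F 𝔠 γ hγ hγ1 hc hA₁ (startClosed_of_weakClosed_avT3 F hA₁ hN08)

/-! ## §4 hJ(v3) from hTop (the WORD-68 letter), flat -/

/-- ★★★ **hJ(v3) AT ITS EXACT DISPLAY LETTER FROM hTop** (★★OWNER WORD 68's v5-candidate row: Haar pushed through the block averagings of EVERY segment `j … K`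
ending at the unit torus has density `≤ e^{c}`, `c` uniform in `K`; w3's K-23-TOP binder VERBATIM) — FLAT (no `K + 1`), via px8's
✓`startClosed_avT3_of_topHaarPushforward` and §3. [cite: Balaban1985UV3, (41) p.266 + (5) p.256 (the masses; bookkeeping)] -/
theorem _root_.Summit.QuantumFields.YangMills.Theorems.AlphaInputsT3AC.OfV3At.hJ_of_topHaarPushforward {a₀ a₁ : ℝ}
    (h : AlphaInputsT3AC.OfV3At F 𝔠 a₀ a₁) (hc : 0 < a₀ ∧ 0 < a₁ ∧ 𝔠.B₃ * a₁ ≤ a₀)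
    (hTop : ∃ c : ℝ, 0 ≤ c ∧ ∀ (K j n : ℕ), j + n = K →
      (fieldMeasure (F.P K) j (Matrix.specialUnitaryGroup (Fin 2) ℂ)).map (iterFrom (avT3 F K) j n) ≤
        ENNReal.ofReal (Real.exp c) • fieldMeasure (F.P K) (j + n) (Matrix.specialUnitaryGroup (Fin 2) ℂ)) :
    ∃ A₁ : ℝ, ∀ (K : ℕ) (r : Hist (F.P K) K),
      Hist.Admissible 𝔠.lane.carrier.M₁ (rcolOf (T3Scales F γ hγ (hγ1.trans (sq_min_one_le _ 𝔠.gamma0_pos)) K) 𝔠.lane.carrier) K r →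
      r ≠ Hist.triv (F.P K) K →
      ∀ᵐ W ∂(fieldMeasure (F.P K) K (Matrix.specialUnitaryGroup (Fin 2) ℂ)),
        PinnedStep.massP 𝔠.lane (h.pkgAtV3 hc γ hγ hγ1 K).X K r W ≤ Real.exp A₁ := by
  obtain ⟨A₁, hA₁, hsc⟩ := startClosed_avT3_of_topHaarPushforward F hTop
  exact h.hJ_of_startClosed_avT3 F 𝔠 γ hγ hγ1 hc hA₁ hsc

/-- ★★ **THE SAME WITH THE CRUX'S AVERAGING `blockAvg ℰp` SPELLED OUT** (`avT3 F K i = blockAvg ℰp` for `i ≤ F.m + K`, ✓`iterFrom_avT3_eq_iterFrom_blockAvg`).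
[cite: Balaban1985UV3, (41) p.266 + (2) p.256 (the masses; bookkeeping)] -/
theorem _root_.Summit.QuantumFields.YangMills.Theorems.AlphaInputsT3AC.OfV3At.hJ_of_topBlockAvgPushforward {a₀ a₁ : ℝ}
    (h : AlphaInputsT3AC.OfV3At F 𝔠 a₀ a₁) (hc : 0 < a₀ ∧ 0 < a₁ ∧ 𝔠.B₃ * a₁ ≤ a₀)
    (hTopB : ∃ c : ℝ, 0 ≤ c ∧ ∀ (K j n : ℕ), j + n = K →
      (fieldMeasure (F.P K) j (Matrix.specialUnitaryGroup (Fin 2) ℂ)).map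
          (iterFrom (fun i => BlockAveraging.blockAvg (P := F.P K) (G := Matrix.specialUnitaryGroup (Fin 2) ℂ) (j := i) ℰp) j n) ≤
        ENNReal.ofReal (Real.exp c) • fieldMeasure (F.P K) (j + n) (Matrix.specialUnitaryGroup (Fin 2) ℂ)) :
    ∃ A₁ : ℝ, ∀ (K : ℕ) (r : Hist (F.P K) K),
      Hist.Admissible 𝔠.lane.carrier.M₁ (rcolOf (T3Scales F γ hγ (hγ1.trans (sq_min_one_le _ 𝔠.gamma0_pos)) K) 𝔠.lane.carrier) K r →
      r ≠ Hist.triv (F.P K) K →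
      ∀ᵐ W ∂(fieldMeasure (F.P K) K (Matrix.specialUnitaryGroup (Fin 2) ℂ)),
        PinnedStep.massP 𝔠.lane (h.pkgAtV3 hc γ hγ hγ1 K).X K r W ≤ Real.exp A₁ := by
  obtain ⟨c, hc0, hcB⟩ := hTopB
  refine h.hJ_of_topHaarPushforward F 𝔠 γ hγ hγ1 hc ⟨c, hc0, fun K j n hjn => ?_⟩
  rw [iterFrom_avT3_eq_iterFrom_blockAvg F K j n (by omega)]
  exact hcB K j n hjn

end Summit.QuantumFields.YangMills.Theorems.UV3PinnedMassEnvelopeV3OfN08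

end
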